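import Literature.MathematicalPhysics.QuantumFieldTheory.Balaban1983to89.B6SectAOperatorsV1

/-!
# `Balaban1983to89.B8Eq12HodgeLaplacianV1` — T. Bałaban, *Spaces of regular gauge field configurations on a lattice and gauge fixing
# conditions*, Commun. Math. Phys. **99** (1985) 75–102 [Balaban1985RegularSpaces], **(1.2)** p. 76 (the divergence `D^{η*}_U` of plaquette
# functions) AT THE FLAT BACKGROUND `U = 1` ON THE V1 `ℓ²` CARRIERS: it IS the `ℓ²`-adjoint `dcsE := (dcE)†` of the curl ([4] (3.9) «the
# operator adjoint to derivative D, acting on functions defined at bonds»), and THE FLAT LATTICE WEITZENBÖCK IDENTITY IN OPERATOR FORM,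
# [B5] (1.69) «Δ = ∂*∂ + ∂∂*» with (1.21)'s «η-lattice Laplace operator for scalar functions» acting on the components — so that the
# operator `Δ^η_{U₀}` of (1.39)/(1.59) ([4] (3.23) `Δ^η_U = Σ_μ D^{η*}_{U,μ}D^η_{U,μ}`) at `U₀ = 1` is `∂*∂ + ∂∂* = dcsE c ∘ dcE c + dE c ∘ dsE c`

statement-level skeleton of published theorems with citation tags; proofs where landed; nothing here is a claim about the Yang–Mills mass gap

PDF held: `paper:balaban1985-cmp99-regular-spaces-gauge-fixing` (journal page = PDF page + 74); p. 76 [PDF 2] (1.1)–(1.2), p. 83 [PDF 9] (1.39),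
p. 86 [PDF 12] (1.58)–(1.59) re-read this generation on the text layer (`lit read … --pages 1-14`: p0002.txt L27–L39, p0009.txt L9–L11, p0012.txt
L22–L27).  [B5] = T. Bałaban, *Propagators and renormalization transformations for lattice gauge theories. I*, Commun. Math. Phys. **95** (1984)
17–40 [Balaban1984PropagatorsI], (1.21) p. 21 [PDF 5] and (1.69) p. 29 [PDF 13] re-read this generation (`paper:balaban1984-cmp95-propagators-rt-i`
p0005.txt L2–L8, p0013.txt L25–L28); [B6] = *… II*, Commun. Math. Phys. **96** (1984) 223–250 [Balaban1984PropagatorsII], (2.19) p. 226 [PDF 4]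
(`paper:balaban1984-cmp96-propagators-rt-ii` p0004.txt L12); [4] = T. Bałaban, *Propagators for lattice gauge theories in a background field*, Commun.
Math. Phys. **99** (1985) 389–434 [Balaban1985BackgroundPropagators], (3.8)–(3.9) p. 392 [PDF 4] and (3.23) p. 394 [PDF 6]
(`paper:balaban1985-cmp99-background-propagators` p0004.txt L2–L13, p0006.txt L13–L14).

CITATION HEADER (lean-in-tree rule).  Cell `lit-balaban` (HOME `run/shared/lean/pub/lit-balaban/`), unit `lit-balaban-r05` gen 64 (B8 reader/typer and
fold owner; free target under protocol G.5-34(d) = B8-CLOSURE §5 item 2 (v), TAKING HOME/STATUS.md 2026-08-23T08:27Z, courtesy lines to r02 (row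
B5.Eq1.21 owner), r03 / p21 (the V1 operators `dcE`, `dcsE`), p22 (the B6 lane's componentwise `Lap`); the successor step named in
`B8Prop3MultiLevelTorusLap` p357572 ACCEPTED commit ab393f6fc581, HONEST SCOPE (ii), HOME/lit-balaban-r05/HANDOFF.md § gen 63).  WHAT IS REPRODUCED =
SKELETON rows **B8.Eq1.2** (cells: the flat instance of (1.2) identified with the V1 adjoint) and **B8.Eq1.59** / **B8.Eq1.39** / **B8.Prop3** (cells: the
OPERATOR in the member `|Δ^η_{U₀}A|` at `U₀ = 1`), with courtesy readings of rows B5.Eq1.21 / B5.Eq1.69 (r02; p37's form-level `B5Eq121Form` is the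
row's file of record) and B9.Eq3.9 / B9.Eq3.23 (r06; `B9Eq39Adjoint` on the abstract lattice is the file of record), as «kernel-checked proofs of a
model instance» on the V1 `ℓ²` carriers of r03/p21's `B6SectAOperatorsV1` (`BondSpace P = ℓ²(bonds of T_η)`, `PlaqSpace P = ℓ²(plaquettes)`,
`ScalarSpace P = ℓ²(sites)`; `dE c = ∂` (gradient), `dsE c = ∂*` (divergence), `dcE c = ∂` on vector fields (the curl, plaquette variable),
`dcsE c := LinearMap.adjoint (dcE c)`; `ℓ²` pairings WITHOUT the volume factor `η^d`, which changes no operator identity).  Heads do not move.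

WHY (the consumer).  `B8Prop3MultiLevelTorusLap.prop3_multiLevelTorus_V1_pref_lap` (gen 63) proves (1.59)'s fourth member and Proposition 3 at
`U₀ = 1` on the `k`-level V1 torus for print's flat vector Laplacian written as `∂*∂ + ∂∂* = dcsE c ∘ dcE c + dE c ∘ dsE c` ([B5] (1.69), [B6]
(2.19)), and records as NOT restated (HONEST SCOPE (ii) there) the identification of that operator with (α) print's own `Δ^η_{U₀}` at `U₀ = 1` —
[4] (3.23) `Σ_μ D^{η*}_{U,μ}D^η_{U,μ}` acting on each component `A_μ`, i.e. the COMPONENTWISE scalar Laplacian `Σ_ν ∂*_ν∂_ν` — and (β) the B6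
lane's componentwise spelling `Σ_ν (c(S_ν⁻¹ − 1))∘(c(S_ν − 1))` (`B6BlockDecayGLapBridgeV1.Lap_apply`, `B6LapCommutesGradV1`, the `ΔG_□` legs of
p22), while r03's chart file `B6AgreeLapV1Chart` (l. 922) uses the Hodge spelling `onFun (dcsE c ∘ dcE c + dE c ∘ dsE c)`.  The two spellings agree
by the flat lattice Weitzenböck identity; this file puts it in the tree as an OPERATOR identity on `BondSpace P` (§2), after computing the adjoint
`dcsE` pointwise (§1) — which is (1.2) at `U = 1`, word for word.  Imports: `B6SectAOperatorsV1` only (closure 15 modules), so that every V1 file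
can use the identity without the B8 Prop-3 chain.

WHAT IS PRINTED (verbatim, text layers as above).  [B8] p. 76: *"Let us recall the definition of a covariant derivative on a lattice. For a function
F defined on a subset of the lattice T_η, with values in complex N×N matrices, we define (D^η_{U,μ}F)(x) = η⁻¹(R(U(x, x + ηe_μ))F(x + ηe_μ) − F(x)),
(D^{η*}_{U,μ}F)(x) = η⁻¹(R(U(x, x − ηe_μ))F(x − ηe_μ) − F(x)), (1.1) where U is an arbitrary gauge field configuration, and R(U)X = UXU⁻¹ for a
unitary matrix U and an arbitrary X. Let F be a function defined at plaquettes of a subset of T_η. Let us denote by p_{μν}(x) a plaquette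
determined by the point x and vectors e_μ, e_ν, μ < ν, i.e., p_{μν}(x) = ⟨x, x + ηe_μ, x + ηe_μ + ηe_ν, x + ηe_ν⟩, and let F_{μν}(x) = F(p_{μν}(x)).
We define (D^{η*}_U F)(x, x + ηe_μ) = (D^{η*}_U F)_μ(x) = Σ_{ν<μ} (D^{η*}_{U,ν}F_{νμ})(x) − Σ_{ν>μ} (D^{η*}_{U,ν}F_{μν})(x). (1.2) Of course these
definitions hold for an arbitrary lattice with an arbitrary scale instead of η."*  [4] p. 392: *"The operator adjoint to derivative D, acting on
functions defined at bonds, is the operator acting on functions F defined at plaquetts by the formula (D*F)(x, x + ηe_μ) = (D*F)_μ(x) = Σ_{ν<μ}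
(D*_νF_{νμ})(x) − Σ_{ν>μ} (D*_νF_{μν})(x) = Σ_{ν=1}^{d} (D*_νF_{νμ})(x), (3.9) where F_{μν}(x) = F(p_{μν}(x)), and in the last equality above we
have assumed that F_{μν}(x) = −F_{νμ}(x)."*; p. 394: *"In the above formulas Δ^η_U is the covariant Laplce operator Δ^η_U = D^{η*}_U D^η_U =
Σ_{μ=1}^{d} D^{η*}_{U,μ}D^η_{U,μ} (3.23)"* [sic «Laplce»].  [B5] p. 21: *"The action can be written as ⟨∂A, ∂A⟩ = ½ Σ_{x∈T_η,μ,ν} η^d|F_{μν}(x)|² =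
… = Σ_μ ⟨A_μ, ΔA_μ⟩ − ⟨∂*A, ∂*A⟩, (1.21) where Δ is η-lattice Laplace operator for scalar functions and ∂* is the divergence operator for vector
functions, ∂*A = Σ_μ ∂*_μA_μ."*; p. 29: *"The quadratic form in the fields A in the exponential is equal to ⟨A, Δ_aA⟩ = ⟨A, ∂*∂A⟩ + ⟨A, ∂R∂*A⟩ +
a⟨A, Q*QA⟩ = ⟨A, ΔA⟩ − ⟨A, ∂P∂*A⟩ + a⟨A, Q*QA⟩, (1.69) Δ = ∂*∂ + ∂∂*, R = I − P"*.  [B6] p. 226: *"Δ_a = ∂*∂ + ∂R∂* + Q*aQ = Δ − ∂P∂* + Q*aQ,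
(2.19)"*.  [B8] p. 86: *"Theorem 3.3 of [4] implies the bounds: |A|₍₋₁₎, |∇^η_{U₀}A|₍₋₂₎, |D^{η*}_{U₀}D^η_{U₀}A|₍₋₃₎, |Δ^η_{U₀}A|₍₋₃₎ ≦ B₀(|J|₍₋₃₎ + |B₁|)
(1.59)"*; p. 83: *"|D^{η*}_{U₀}D^η_{U₀}A|, |Δ^η_{U₀}A| < B₁(α₀ + α₁)(L^jη)⁻³ on Ω_j, j = 0, 1, …, k. (1.39)"*.

WHAT THIS FILE PROVES (theorems only; 0 `def`, 0 `def … : Prop`, 0 sorry; axioms standard; V1 conventions of `LatticeFieldCalculus`: forward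
difference `(∂_νf)(x) = c(f(x + e_ν) − f(x))` = `pdiff c ν`, its `ℓ²`-adjoint `(∂*_νf)(x) = c(f(x − e_ν) − f(x))` = `pdiffAdj c ν`, lattice factor
`c = η⁻¹` ARBITRARY real, positively oriented plaquettes `p_{μν}(x)`, `μ < ν`, of `Setup.Plaq`).
* §1 **(1.2) AT `U = 1` = THE ADJOINT OF THE CURL.**  `sum_divPlaq_one_mul` — summation by parts on every torus `T^{(j)}`, plain functions:
  `Σ_b [Σ_{ν<μ}(∂*_νF_{νμ})(x) − Σ_{ν>μ}(∂*_νF_{μν})(x)]_{b=⟨x,μ⟩}·A(b) = Σ_p F(p)(∂A)(p)` ([4] (3.9)'s sentence, flat); **`dcsE_apply`** — for r03/p21's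
  `dcsE c := (dcE c)†` on `PlaqSpace P → BondSpace P`: `(dcsE c F)⟨x, μ⟩ = Σ_{ν<μ}(∂*_νF_{νμ})(x) − Σ_{ν>μ}(∂*_νF_{μν})(x)`, the printed (1.2) with
  `D^{η*}_{U,ν} ↦ ∂*_ν`; `ofLp_dcsE_eq_covDivPlaq_one` — the same as an equality with the cross-paper object `LatticeFieldCalculus.covDivPlaq R c 1`
  ((1.2) as typed for `Setup.GaugeField`, any gauge group, any representation with `R(1) = 1`).
* §2 **WEITZENBÖCK, OPERATOR FORM.**  **`hodge_apply`** — `((dcsE c ∘ dcE c + dE c ∘ dsE c)A)⟨x, μ⟩ = (ΔA_μ)(x)`, `Δ = laplace c = Σ_ν ∂*_ν∂_ν`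
  (`(Δf)(x) = Σ_ν c²(2f(x) − f(x + e_ν) − f(x − e_ν))`) on the component `A_μ = fun z => A⟨z, μ⟩`; `ofLp_hodge` (function form);
  **`hodge_eq_sum_DadjD`** — the LINEAR-MAP identity `dcsE c ∘ₗ dcE c + dE c ∘ₗ dsE c = Σ_ν (c • (S_ν⁻¹ − 1)) ∘ₗ (c • (S_ν − 1))` in the exact
  spelling of `B6BlockDecayGLapBridgeV1.Lap_apply` / `B6LapCommutesGradV1.Lap_comp_dE`; `inner_dcE_self_add_inner_dsE_self` — (1.21) on `ℓ²`:
  `⟨∂A, ∂A⟩ + ⟨∂*A, ∂*A⟩ = Σ_μ Σ_x A_μ(x)(ΔA_μ)(x)`.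
* §3 **THE OPERATOR OF (1.39)/(1.59)'s LAST MEMBER AT `U₀ = 1`.**  `sum_covDAdj_covD_one` — [4] (3.23) at `U = 1`: `Σ_μ D^{η*}_{1,μ}D^η_{1,μ}f =
  Δf` (`LatticeFieldCalculus.covD/covDAdj` at the configuration `1`, any representation with `R(1) = 1`, any level, any module of values);
  **`hodge_apply_eq_sum_covDAdj_covD_one`** — `((∂*∂ + ∂∂*)A)⟨x, μ⟩ = (Σ_ν D^{η*}_{1,ν}D^η_{1,ν}A_μ)(x)`: the operator in the fourth member of
  `B8Prop3MultiLevelTorusLap.prop3_multiLevelTorus_V1_pref_lap` IS print's `Δ^η_{U₀}` at `U₀ = 1`.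

HONEST SCOPE / NOT CLAIMED.  (i) Flat background only (`U = 1`): the covariant (1.2)/(3.9)/(3.23) with a general `U` and matrix values are
`B9Eq39Adjoint` (abstract lattice, trace pairing; `sum_curl_mul` = (3.9)'s adjointness with an exact background) and `B11Eq135Weitzenbock` (the
exact-background Weitzenböck identity (135) of CMP 102 with its curvature term) — other carriers, not bridged here; at `U = 1` the curvature term is
absent and the identity is the flat one proved here.  (ii) Real scalar fibre (`ℝ`-valued bond/plaquette functions), as the whole V1 calculus; the
printed fields are `𝔤`-valued — componentwise in an orthonormal basis the identities are the same, not spelled out.  (iii) Level `0` torus `T_η` of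
`Setup.Params` for the `ℓ²` statements (the carriers of `B6SectAOperatorsV1`); §1's summation by parts and §3's (3.23) instance at every level `j`.
(iv) No estimate and no head moves: rows B8.Eq1.2 / B8.Eq1.39 / B8.Eq1.59 / B8.Prop3 cells only (the vector side of Prop. 3 at `U₀ = 1` stays modulo
(2.136)₁,₂, `B8Prop3MultiLevelTorusLap`); the member-4 restatement of `prop3_multiLevelTorus_V1_pref_lap` for the componentwise `Δ` is a one-line
`rw [ofLp_hodge]` left to that file's next version step.  NOT summit progress, NOT continuum, NOT Clay.

RELATED IN THE TREE, NOT DUPLICATED (stem check 2026-08-23T08:25Z: `grep -l dcsE Balaban1983to89/*.lean` = 23 files, none with a pointwise formula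
for `dcsE` — `B6AgreeLapV1Chart.toMatrix'_dcsE` is the transpose statement only; Weitzenböck-type identities in the tree: `B5Action121.curl_adjoint_curl`
(pub-balaban pass, carrier `Tor N × Fin d → ℂ`, ordered-pair plaquettes with the factor 2), `B5Eq121Form.eq121` (p37: (1.21) at the quadratic-form
level on the V1 function carriers with weights — the form identity from which §2 differs by being the operator statement for the `ℓ²` adjoint),
`HiggsHodgeIdentity.vecLaplaceForm_eq_curl_add_div` (form level, Higgs lattice), `B11Eq135Weitzenbock.eq135` (exact background, [5] §A carrier),
`B9Eq39Adjoint.sum_curl_mul` ((3.9) with background, abstract carrier)): `B6SectAOperatorsV1.dcsE/dcE/dE/dsE/inner_dcsE_left/inner_dE_left/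
inner_eq_sum/dcE_apply/dsE_apply/dE_apply`, `LatticeFieldCalculus.curl/grad/diverg/laplace/pdiffAdj/covD/covDAdj/covDivPlaq/covD_one/covDAdj_one/
laplace_apply` (USED BY NAME, nothing re-declared; three private torus-translation lemmas, two private iterated-sum lemmas, the translation
invariance of `Σ_x` and the evaluation of `c·(S_g − 1)` are the usual local plumbing).
-/

open scoped InnerProductSpace BigOperators

namespace Literature.MathematicalPhysics.QuantumFieldTheory.Balaban1983to89.B8Eq12HodgeLaplacianV1

open Finset LatticeFieldCalculus B6SectAOperatorsV1
open BalabanImbrieJaffe1984to88.BIJ85AxialPropagator411 (BondSpace PlaqSpace)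

noncomputable section

variable {P : Params} {j : ℕ}

/-! ## §0. Site and summation helpers (torus translations; sums over bonds and plaquettes as iterated sums) -/

/-- `(x − e_μ) + e_μ = x`. [folklore] -/
private theorem shift_unshift' (x : Site P j) (μ : Fin P.d) : (x.unshift μ).shift μ = x := by
  funext ν
  by_cases h : ν = μ
  · subst h; simp [Site.shift, Site.unshift]
  · simp [Site.shift, Site.unshift, Function.update_of_ne h]

/-- `(x + e_μ) − e_μ = x`. [folklore] -/
private theorem unshift_shift' (x : Site P j) (μ : Fin P.d) : (x.shift μ).unshift μ = x := by
  funext ν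
  by_cases h : ν = μ
  · subst h; simp [Site.shift, Site.unshift]
  · simp [Site.shift, Site.unshift, Function.update_of_ne h]

/-- `(x + e_ν) − e_μ = (x − e_μ) + e_ν` (also for `μ = ν`). [folklore] -/
private theorem unshift_shift_comm' (x : Site P j) (μ ν : Fin P.d) : (x.shift ν).unshift μ = (x.unshift μ).shift ν := by
  by_cases h : μ = ν
  · subst h; rw [unshift_shift', shift_unshift']
  · funext κ
    simp only [Site.shift, Site.unshift]
    by_cases h1 : κ = μ
    · subst h1; simp [Function.update_self, Function.update_of_ne h]
    · by_cases h2 : κ = ν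
      · subst h2; simp [Function.update_self, Function.update_of_ne (Ne.symm h)]
      · simp [Function.update_of_ne h1, Function.update_of_ne h2]

/-- A sum over bonds is a double sum over sites and directions. [folklore] -/
private theorem sum_bond_eq' {α : Type*} [AddCommMonoid α] (F : PBond P j → α) :
    ∑ b : PBond P j, F b = ∑ x : Site P j, ∑ μ : Fin P.d, F ⟨x, μ⟩ := by
  rw [← Fintype.sum_prod_type']
  exact Fintype.sum_equiv (⟨fun b => (b.src, b.dir), fun p => ⟨p.1, p.2⟩, fun _ => rfl, fun _ => rfl⟩ :
    PBond P j ≃ Site P j × Fin P.d) _ _ fun _ => rfl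

/-- A sum over the positively oriented plaquettes `p_{μν}(x)`, `μ < ν`, is the sum over sites and over the pairs `μ < ν`
(dependent form: the summand may use the proof of `μ < ν`). [folklore] -/
private theorem sum_plaq_eq' {α : Type*} [AddCommMonoid α] (G : Plaq P j → α) :
    ∑ p : Plaq P j, G p
      = ∑ x : Site P j, ∑ μ : Fin P.d, ∑ ν : Fin P.d, if h : μ < ν then G ⟨x, μ, ν, h⟩ else 0 := by
  set G' : Site P j × Fin P.d × Fin P.d → α := fun t => if h : t.2.1 < t.2.2 then G ⟨t.1, t.2.1, t.2.2, h⟩ else 0 with hG'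
  have h1 : (∑ x : Site P j, ∑ μ : Fin P.d, ∑ ν : Fin P.d, if h : μ < ν then G ⟨x, μ, ν, h⟩ else 0)
      = ∑ t : Site P j × Fin P.d × Fin P.d, G' t := by
    rw [Fintype.sum_prod_type]
    refine Finset.sum_congr rfl fun x _ => ?_
    rw [Fintype.sum_prod_type]
  have h2 : (∑ t : Site P j × Fin P.d × Fin P.d, G' t)
      = ∑ t ∈ (Finset.univ.filter fun t : Site P j × Fin P.d × Fin P.d => t.2.1 < t.2.2), G' t := by
    rw [Finset.sum_filter]
    refine Finset.sum_congr rfl fun t _ => ?_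
    by_cases ht : t.2.1 < t.2.2
    · rw [if_pos ht]
    · rw [if_neg ht, hG']
      exact dif_neg ht
  have h3 : (∑ t ∈ (Finset.univ.filter fun t : Site P j × Fin P.d × Fin P.d => t.2.1 < t.2.2), G' t)
      = ∑ t : {t : Site P j × Fin P.d × Fin P.d // t.2.1 < t.2.2}, G' t.1 := by
    apply Finset.sum_subtype
    intro t
    simp
  have h4 : (∑ t : {t : Site P j × Fin P.d × Fin P.d // t.2.1 < t.2.2}, G' t.1) = ∑ p : Plaq P j, G p := by
    refine Fintype.sum_equiv ⟨fun t => ⟨t.1.1, t.1.2.1, t.1.2.2, t.2⟩, fun p => ⟨(p.src, p.μ, p.ν), p.hμν⟩,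
      fun _ => rfl, fun _ => rfl⟩ _ _ fun t => ?_
    rw [hG']
    exact dif_pos t.2
  rw [h1, h2, h3, h4]

/-- Translation invariance of the sum over the torus: `Σ_x f(x + e_μ) = Σ_x f(x)`. [folklore] -/
private theorem sum_shift' {α : Type*} [AddCommMonoid α] (μ : Fin P.d) (f : Site P j → α) :
    ∑ x : Site P j, f (x.shift μ) = ∑ x : Site P j, f x :=
  Fintype.sum_equiv ⟨fun x => x.shift μ, fun x => x.unshift μ, fun x => unshift_shift' x μ, fun x => shift_unshift' x μ⟩ _ _
    fun _ => rfl

/-! ## §1. [B8] (1.2) at `U = 1`: the divergence `∂*` of plaquette functions IS the `ℓ²`-adjoint of the curl `∂` on vector fields -/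

/-- **SUMMATION BY PARTS FOR THE PLAQUETTE DIVERGENCE** ([B8] (1.2) p. 76 at `U = 1`, the background dropped: *"(D^{η*}_U F)(x, x + ηe_μ)
= (D^{η*}_U F)_μ(x) = Σ_{ν<μ} (D^{η*}_{U,ν} F_{νμ})(x) − Σ_{ν>μ} (D^{η*}_{U,ν} F_{μν})(x)"* with `D^{η*}_{1,ν} = ∂*_ν`, `(∂*_ν f)(x) =
c(f(x − e_ν) − f(x))` = `LatticeFieldCalculus.pdiffAdj`): for every plaquette function `F` and every vector (bond) field `A` on the torus
`T^{(j)}`, `Σ_b (∂*F)(b)·A(b) = Σ_p F(p)·(∂A)(p)`, the sum over the positively oriented plaquettes `p = p_{μν}(x)`, `μ < ν`, `∂A` = the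
plaquette variable `LatticeFieldCalculus.curl` ([B5] (1.2)).  Whole torus, every level `j`, every lattice factor `c`; real fields.
[cite: Balaban1985RegularSpaces, (1.2) p.76; Balaban1984PropagatorsI, (1.2) p.18] -/
theorem sum_divPlaq_one_mul (c : ℝ) (F : Plaq P j → ℝ) (A : VecField P j ℝ) :
    ∑ b : PBond P j, ((∑ ν, if h : ν < b.dir then pdiffAdj c ν (fun z => F ⟨z, ν, b.dir, h⟩) b.src else 0)
        - ∑ ν, if h : b.dir < ν then pdiffAdj c ν (fun z => F ⟨z, b.dir, ν, h⟩) b.src else 0) * A b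
      = ∑ p : Plaq P j, F p * curl c A p := by
  classical
  set T : Site P j → Fin P.d → Fin P.d → ℝ := fun x μ ν => if h : μ < ν then F ⟨x, μ, ν, h⟩ else 0 with hT
  -- the bond side, written with the extension `T` of `F` by zero to all ordered pairs
  have hL : ∀ (x : Site P j) (κ : Fin P.d),
      ((∑ ν, if h : ν < κ then pdiffAdj c ν (fun z => F ⟨z, ν, κ, h⟩) x else 0)
        - ∑ ν, if h : κ < ν then pdiffAdj c ν (fun z => F ⟨z, κ, ν, h⟩) x else 0)
      = ∑ ν, (c * T (x.unshift ν) ν κ - c * T x ν κ - c * T (x.unshift ν) κ ν + c * T x κ ν) := by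
    intro x κ
    rw [← Finset.sum_sub_distrib]
    refine Finset.sum_congr rfl fun ν _ => ?_
    by_cases h1 : ν < κ
    · have h2 : ¬ κ < ν := lt_asymm h1
      rw [dif_pos h1, dif_neg h2]
      simp only [pdiffAdj, hT, dif_pos h1, dif_neg h2, smul_eq_mul]
      ring
    · rw [dif_neg h1]
      by_cases h2 : κ < ν
      · rw [dif_pos h2]
        simp only [pdiffAdj, hT, dif_neg h1, dif_pos h2, smul_eq_mul]
        ring
      · rw [dif_neg h2]
        simp only [hT, dif_neg h1, dif_neg h2]
        ring
  -- the plaquette side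
  have hR : ∑ p : Plaq P j, F p * curl c A p
      = ∑ x : Site P j, ∑ μ : Fin P.d, ∑ ν : Fin P.d, (c * T x μ ν * A ⟨x, μ⟩ + c * T x μ ν * A ⟨x.shift μ, ν⟩
          - c * T x μ ν * A ⟨x.shift ν, μ⟩ - c * T x μ ν * A ⟨x, ν⟩) := by
    rw [sum_plaq_eq']
    refine sum_congr rfl fun x _ => sum_congr rfl fun μ _ => sum_congr rfl fun ν _ => ?_
    by_cases h : μ < ν
    · rw [dif_pos h]
      simp only [curl, hT, dif_pos h, smul_eq_mul]
      ring
    · rw [dif_neg h]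
      simp only [hT, dif_neg h]
      ring
  -- three re-indexings (commuting the direction sums; translating the site sum)
  have e1 : (∑ x : Site P j, ∑ κ : Fin P.d, ∑ ν : Fin P.d, c * T (x.unshift ν) ν κ * A ⟨x, κ⟩)
      = ∑ x : Site P j, ∑ μ : Fin P.d, ∑ ν : Fin P.d, c * T x μ ν * A ⟨x.shift μ, ν⟩ := by
    calc (∑ x : Site P j, ∑ κ : Fin P.d, ∑ ν : Fin P.d, c * T (x.unshift ν) ν κ * A ⟨x, κ⟩)
        = ∑ x : Site P j, ∑ ν : Fin P.d, ∑ κ : Fin P.d, c * T (x.unshift ν) ν κ * A ⟨x, κ⟩ :=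
          sum_congr rfl fun x _ => sum_comm
      _ = ∑ ν : Fin P.d, ∑ x : Site P j, ∑ κ : Fin P.d, c * T (x.unshift ν) ν κ * A ⟨x, κ⟩ := sum_comm
      _ = ∑ ν : Fin P.d, ∑ x : Site P j, ∑ κ : Fin P.d, c * T x ν κ * A ⟨x.shift ν, κ⟩ := by
          refine sum_congr rfl fun ν _ => ?_
          rw [← sum_shift' ν (fun x => ∑ κ : Fin P.d, c * T (x.unshift ν) ν κ * A ⟨x, κ⟩)]
          simp only [unshift_shift']
      _ = ∑ x : Site P j, ∑ ν : Fin P.d, ∑ κ : Fin P.d, c * T x ν κ * A ⟨x.shift ν, κ⟩ := sum_comm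
  have e2 : (∑ x : Site P j, ∑ κ : Fin P.d, ∑ ν : Fin P.d, c * T x ν κ * A ⟨x, κ⟩)
      = ∑ x : Site P j, ∑ μ : Fin P.d, ∑ ν : Fin P.d, c * T x μ ν * A ⟨x, ν⟩ :=
    sum_congr rfl fun x _ => sum_comm
  have e3 : (∑ x : Site P j, ∑ κ : Fin P.d, ∑ ν : Fin P.d, c * T (x.unshift ν) κ ν * A ⟨x, κ⟩)
      = ∑ x : Site P j, ∑ μ : Fin P.d, ∑ ν : Fin P.d, c * T x μ ν * A ⟨x.shift ν, μ⟩ := by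
    calc (∑ x : Site P j, ∑ κ : Fin P.d, ∑ ν : Fin P.d, c * T (x.unshift ν) κ ν * A ⟨x, κ⟩)
        = ∑ x : Site P j, ∑ ν : Fin P.d, ∑ κ : Fin P.d, c * T (x.unshift ν) κ ν * A ⟨x, κ⟩ :=
          sum_congr rfl fun x _ => sum_comm
      _ = ∑ ν : Fin P.d, ∑ x : Site P j, ∑ κ : Fin P.d, c * T (x.unshift ν) κ ν * A ⟨x, κ⟩ := sum_comm
      _ = ∑ ν : Fin P.d, ∑ x : Site P j, ∑ κ : Fin P.d, c * T x κ ν * A ⟨x.shift ν, κ⟩ := by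
          refine sum_congr rfl fun ν _ => ?_
          rw [← sum_shift' ν (fun x => ∑ κ : Fin P.d, c * T (x.unshift ν) κ ν * A ⟨x, κ⟩)]
          simp only [unshift_shift']
      _ = ∑ x : Site P j, ∑ ν : Fin P.d, ∑ κ : Fin P.d, c * T x κ ν * A ⟨x.shift ν, κ⟩ := sum_comm
      _ = ∑ x : Site P j, ∑ κ : Fin P.d, ∑ ν : Fin P.d, c * T x κ ν * A ⟨x.shift ν, κ⟩ :=
          sum_congr rfl fun x _ => sum_comm
  rw [hR, sum_bond_eq']
  simp_rw [hL]
  simp only [Finset.sum_mul, sub_mul, add_mul, Finset.sum_add_distrib, Finset.sum_sub_distrib]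
  rw [e1, e2, e3]
  ring

/-- **[B8] (1.2) AT `U = 1` IS THE `ℓ²`-ADJOINT OF THE CURL.**  p. 76 [PDF 2], verbatim: *"Let F be a function defined at plaquettes of a
subset of T_η. Let us denote by p_{μν}(x) a plaquette determined by the point x and vectors e_μ, e_ν, μ < ν, i.e., p_{μν}(x) = ⟨x, x + ηe_μ,
x + ηe_μ + ηe_ν, x + ηe_ν⟩, and let F_{μν}(x) = F(p_{μν}(x)). We define (D^{η*}_U F)(x, x + ηe_μ) = (D^{η*}_U F)_μ(x) = Σ_{ν<μ} (D^{η*}_{U,ν}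
F_{νμ})(x) − Σ_{ν>μ} (D^{η*}_{U,ν} F_{μν})(x). (1.2)"* — typed reading on the V1 `ℓ²` carriers of `B6SectAOperatorsV1` (`PlaqSpace P =
ℓ²(plaquettes of T_η)`, `BondSpace P = ℓ²(bonds)`, pairings without the volume factor): the operator `dcsE c := (dcE c)†` (the ADJOINT of the
curl `dcE c`, [B6] (2.19) «∂*» on plaquette functions, DEFINED in `B6SectAOperatorsV1` through `LinearMap.adjoint`) acts by the printed
formula (1.2) with `U = 1`, i.e. `D^{η*}_{1,ν} = ∂*_ν` (`pdiffAdj c ν`, `(∂*_ν f)(x) = c(f(x − e_ν) − f(x))`):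
`(∂*F)_μ(x) = Σ_{ν<μ} (∂*_ν F_{νμ})(x) − Σ_{ν>μ} (∂*_ν F_{μν})(x)`. [cite: Balaban1985RegularSpaces, (1.2) p.76; Balaban1984PropagatorsII, (2.19) p.226] -/
theorem dcsE_apply (c : ℝ) (F : PlaqSpace P) (b : PBond P 0) :
    dcsE c F b = (∑ ν, if h : ν < b.dir then pdiffAdj c ν (fun z => F ⟨z, ν, b.dir, h⟩) b.src else 0)
        - ∑ ν, if h : b.dir < ν then pdiffAdj c ν (fun z => F ⟨z, b.dir, ν, h⟩) b.src else 0 := by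
  classical
  set G : BondSpace P := WithLp.toLp 2 (fun b : PBond P 0 =>
    (∑ ν, if h : ν < b.dir then pdiffAdj c ν (fun z => F ⟨z, ν, b.dir, h⟩) b.src else 0)
      - ∑ ν, if h : b.dir < ν then pdiffAdj c ν (fun z => F ⟨z, b.dir, ν, h⟩) b.src else 0) with hG
  have key : dcsE c F = G := by
    apply ext_inner_right ℝ
    intro v
    rw [inner_dcsE_left, inner_eq_sum, inner_eq_sum]
    simp only [dcE_apply]
    rw [← sum_divPlaq_one_mul c (WithLp.ofLp F) (WithLp.ofLp v)]
  rw [key]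

/-! ## §2. The flat lattice Weitzenböck identity in OPERATOR form on `ℓ²(bonds)`: `∂*∂ + ∂∂* = Δ` acting on the components
([B5] (1.69) «Δ = ∂*∂ + ∂∂*», (1.21) «Δ is η-lattice Laplace operator for scalar functions») -/

/-- **THE HODGE LAPLACIAN IS THE COMPONENTWISE LAPLACIAN (flat lattice Weitzenböck identity).**  [B5] p. 29, verbatim: *"⟨A, Δ_aA⟩ = ⟨A, ∂*∂A⟩
+ ⟨A, ∂R∂*A⟩ + a⟨A, Q*QA⟩ = ⟨A, ΔA⟩ − ⟨A, ∂P∂*A⟩ + a⟨A, Q*QA⟩, Δ = ∂*∂ + ∂∂*, R = I − P,"* ((1.69)), where `Δ` on vector functions is the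
operator of (1.21) p. 21: *"⟨∂A, ∂A⟩ = … = Σ_μ ⟨A_μ, ΔA_μ⟩ − ⟨∂*A, ∂*A⟩, where Δ is η-lattice Laplace operator for scalar functions and ∂* is
the divergence operator for vector functions, ∂*A = Σ_μ ∂*_μ A_μ"* — typed reading, pointwise, on the V1 `ℓ²` carriers: for every `A ∈ ℓ²(bonds
of T_η)` and every bond `⟨x, x + e_μ⟩`, `((∂*∂ + ∂∂*)A)_μ(x) = (ΔA_μ)(x) = Σ_ν c²(2A_μ(x) − A_μ(x + e_ν) − A_μ(x − e_ν))` with `∂*∂ + ∂∂* =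
dcsE c ∘ dcE c + dE c ∘ dsE c` (`∂` on vector fields = the curl `dcE`, `∂*` its adjoint `dcsE`; `∂` on scalars = the gradient `dE`, `∂*` = the
divergence `dsE`) and `Δ = Σ_ν ∂*_ν∂_ν` = `LatticeFieldCalculus.laplace c` applied to the component `A_μ = fun z => A ⟨z, μ⟩`.  Proof = the
computation behind (1.21): §1's formula for `∂*` on plaquette functions, `F_{νμ} = −F_{μν}`, and the commutation of lattice translations.
[cite: Balaban1984PropagatorsI, (1.69) p.29, (1.21) p.21; Balaban1984PropagatorsII, (2.19) p.226] -/
theorem hodge_apply (c : ℝ) (A : BondSpace P) (b : PBond P 0) :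
    (dcsE c (dcE c A) + dE c (dsE c A)) b = laplace c (fun z => A ⟨z, b.dir⟩) b.src := by
  classical
  obtain ⟨x, κ⟩ := b
  rw [PiLp.add_apply, dcsE_apply, dE_apply]
  simp only [grad, PBond.tgt, dsE_apply, diverg, dcE_apply, curl, laplace, smul_eq_mul]
  rw [mul_sub, Finset.mul_sum, Finset.mul_sum, ← Finset.sum_sub_distrib, ← Finset.sum_sub_distrib, ← Finset.sum_add_distrib]
  refine Finset.sum_congr rfl fun ν _ => ?_
  rcases lt_trichotomy ν κ with h | h | h
  · rw [dif_pos h, dif_neg (lt_asymm h)]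
    simp only [pdiffAdj, smul_eq_mul]
    rw [shift_unshift', unshift_shift_comm' x ν κ]
    ring
  · subst h
    simp only [lt_self_iff_false, dif_neg, not_false_eq_true]
    rw [unshift_shift']
    ring
  · rw [dif_neg (lt_asymm h), dif_pos h]
    simp only [pdiffAdj, smul_eq_mul]
    rw [shift_unshift', unshift_shift_comm' x ν κ]
    ring

/-- `(∂*∂ + ∂∂*)A` read as a bond field is the componentwise Laplacian (function form of `hodge_apply`).
[cite: Balaban1984PropagatorsI, (1.69) p.29, (1.21) p.21] -/
theorem ofLp_hodge (c : ℝ) (A : BondSpace P) :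
    WithLp.ofLp (dcsE c (dcE c A) + dE c (dsE c A)) = fun b => laplace c (fun z => A ⟨z, b.dir⟩) b.src :=
  funext (hodge_apply c A)

/-- evaluation of `c·(S_g − 1)` on `ℓ²(bonds)`, `S_g` the pull-back along a bond map `g`. [folklore] -/
private theorem smul_onE_funLeft_sub_id_apply (c : ℝ) (g : PBond P 0 → PBond P 0) (Y : BondSpace P) (b : PBond P 0) :
    ((c • (onE (LinearMap.funLeft ℝ ℝ g) - LinearMap.id) : BondSpace P →ₗ[ℝ] BondSpace P) Y) b = c * (Y (g b) - Y b) := by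
  rw [LinearMap.smul_apply, LinearMap.sub_apply, LinearMap.id_apply, PiLp.smul_apply, PiLp.sub_apply, smul_eq_mul]
  rfl

/-- **THE OPERATOR IDENTITY `∂*∂ + ∂∂* = Σ_ν ∇_ν*∇_ν` ON `ℓ²(bonds of T_η)`** — [B5] (1.69) p. 29 *"Δ = ∂*∂ + ∂∂*"* with the `Δ` of (1.21)
acting on the components, in the spelling of the B6 lane (`∇_ν = c(S_ν − 1)`, `∇_ν* = c(S_ν⁻¹ − 1)`, `S_ν` the translation of the initial
point of the bond by `e_ν`; cf. `B6BlockDecayGLapBridgeV1.Lap_apply`, `B6LapCommutesGradV1.Lap_comp_dE`): as linear maps of `BondSpace P`,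
`dcsE c ∘ dcE c + dE c ∘ dsE c = Σ_ν (c(S_ν⁻¹ − 1)) ∘ (c(S_ν − 1))`. [cite: Balaban1984PropagatorsI, (1.69) p.29, (1.21) p.21; Balaban1984PropagatorsII, (2.19) p.226] -/
theorem hodge_eq_sum_DadjD (c : ℝ) :
    dcsE (P := P) c ∘ₗ dcE c + dE c ∘ₗ dsE c =
      ∑ ν : Fin P.d, ((c • (onE (LinearMap.funLeft ℝ ℝ (fun b : PBond P 0 => (⟨b.src.unshift ν, b.dir⟩ : PBond P 0))) - LinearMap.id) :
          BondSpace P →ₗ[ℝ] BondSpace P)) ∘ₗ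
        ((c • (onE (LinearMap.funLeft ℝ ℝ (fun b : PBond P 0 => (⟨b.src.shift ν, b.dir⟩ : PBond P 0))) - LinearMap.id) :
          BondSpace P →ₗ[ℝ] BondSpace P)) := by
  apply LinearMap.ext
  intro A
  apply PiLp.ext
  intro b
  rw [LinearMap.add_apply, LinearMap.comp_apply, LinearMap.comp_apply, hodge_apply, laplace, LinearMap.sum_apply,
    WithLp.ofLp_sum, Finset.sum_apply]
  refine Finset.sum_congr rfl fun ν _ => ?_
  rw [LinearMap.comp_apply, smul_onE_funLeft_sub_id_apply, smul_onE_funLeft_sub_id_apply, smul_onE_funLeft_sub_id_apply,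
    smul_eq_mul]
  rw [show (⟨(⟨b.src.unshift ν, b.dir⟩ : PBond P 0).src.shift ν, (⟨b.src.unshift ν, b.dir⟩ : PBond P 0).dir⟩ : PBond P 0) = b by
    rw [show (⟨b.src.unshift ν, b.dir⟩ : PBond P 0).src = b.src.unshift ν from rfl, shift_unshift']]
  ring

/-- **(1.21) IN `ℓ²` FORM** (p. 21, the last two members: *"⟨∂A, ∂A⟩ = … = Σ_μ ⟨A_μ, ΔA_μ⟩ − ⟨∂*A, ∂*A⟩"*): on `ℓ²(bonds of T_η)`,
`⟨∂A, ∂A⟩ + ⟨∂*A, ∂*A⟩ = Σ_μ Σ_x A_μ(x)(ΔA_μ)(x)` (= `⟨A, (∂*∂ + ∂∂*)A⟩`; `∂A = dcE c A`, `∂*A = dsE c A`, `Δ = LatticeFieldCalculus.laplace c`;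
pairings without the volume factor `η^d`, which multiplies both sides).  The form-level identity with weights is p37's `B5Eq121Form.eq121` on
the function carriers; this is its operator-level reading through `hodge_apply`. [cite: Balaban1984PropagatorsI, (1.21) p.21] -/
theorem inner_dcE_self_add_inner_dsE_self (c : ℝ) (A : BondSpace P) :
    ⟪dcE c A, dcE c A⟫_ℝ + ⟪dsE c A, dsE c A⟫_ℝ = ∑ μ : Fin P.d, ∑ x : Site P 0, A ⟨x, μ⟩ * laplace c (fun z => A ⟨z, μ⟩) x := by
  rw [← inner_dcsE_left, ← inner_dE_left, ← inner_add_left, inner_eq_sum, sum_bond_eq', Finset.sum_comm]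
  refine sum_congr rfl fun μ _ => sum_congr rfl fun x _ => ?_
  rw [hodge_apply, mul_comm]

/-! ## §3. [4] (3.23) / [B8] (1.39), (1.59): the covariant Laplacian `Δ^η_U = Σ_μ D^{η*}_{U,μ}D^η_{U,μ}` at `U = 1` is this operator -/

/-- **[B8] (1.2) at `U = 1` on the carriers of record.**  For any gauge group and any linear representation `R` with `R(1) = 1`, the
covariant plaquette divergence `LatticeFieldCalculus.covDivPlaq R c U` (= (1.2) as typed in the cross-paper calculus) at the configuration
`U = 1` is the `ℓ²`-adjoint `dcsE c` of the curl: `(D^{η*}_1 F)_μ(x) = (∂*F)_μ(x)`. [cite: Balaban1985RegularSpaces, (1.2) p.76; Balaban1985BackgroundPropagators, (3.9) p.392] -/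
theorem ofLp_dcsE_eq_covDivPlaq_one {G : Type*} [GaugeGroup G] (R : G → ℝ →ₗ[ℝ] ℝ) (hR : R 1 = LinearMap.id) (c : ℝ)
    (F : PlaqSpace P) : WithLp.ofLp (dcsE c F) = covDivPlaq R c (1 : GaugeField P 0 G) (WithLp.ofLp F) := by
  funext b
  rw [covDivPlaq]
  simp only [covDAdj_one R hR]
  exact dcsE_apply c F b

/-- **[4] (3.23) AT `U = 1`** (p. 394, verbatim: *"In the above formulas Δ^η_U is the covariant Laplace operator Δ^η_U = D^{η*}_U D^η_U =
Σ_{μ=1}^{d} D^{η*}_{U,μ} D^η_{U,μ} (3.23)"*; [B8] (1.1) p. 76 for `D^η_{U,μ}`, `D^{η*}_{U,μ}`): at the configuration `U = 1` and any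
representation with `R(1) = 1`, `Σ_μ D^{η*}_{1,μ} D^η_{1,μ} f = Σ_μ ∂*_μ∂_μ f = Δf`, the scalar lattice Laplacian `LatticeFieldCalculus.laplace`
(`covD`/`covDAdj` at `1` are `pdiff`/`pdiffAdj`, `LatticeFieldCalculus.covD_one`/`covDAdj_one`).  Any level `j`, any module of values.
[cite: Balaban1985BackgroundPropagators, (3.23) p.394; Balaban1985RegularSpaces, (1.1) p.76; Balaban1984PropagatorsI, (1.21) p.21] -/
theorem sum_covDAdj_covD_one {G : Type*} [GaugeGroup G] {V : Type*} [AddCommGroup V] [Module ℝ V]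
    (R : G → V →ₗ[ℝ] V) (hR : R 1 = LinearMap.id) (c : ℝ) (f : SiteField P j V) (x : Site P j) :
    ∑ μ : Fin P.d, covDAdj R c (1 : GaugeField P j G) μ (covD R c 1 μ f) x = laplace c f x := by
  rw [laplace_apply]
  simp only [covD_one R hR, covDAdj_one R hR]

/-- **[B8] (1.59)'s FOURTH MEMBER OPERATOR AT `U₀ = 1`.**  p. 86, verbatim: *"Theorem 3.3 of [4] implies the bounds: |A|₍₋₁₎, |∇^η_{U₀}A|₍₋₂₎,
|D^{η*}_{U₀}D^η_{U₀}A|₍₋₃₎, |Δ^η_{U₀}A|₍₋₃₎ ≦ B₀(|J|₍₋₃₎ + |B₁|) (1.59)"*; p. 83: *"we have the following bounds for the second order operators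
acting on A: |D^{η*}_{U₀}D^η_{U₀}A|, |Δ^η_{U₀}A| < B₁(α₀ + α₁)(L^jη)⁻³ on Ω_j, j = 0, 1, …, k. (1.39)"* — typed reading of the OPERATOR in the
last member at the flat background: `Δ^η_{U₀}|_{U₀ = 1}` = [4] (3.23) `Σ_ν D^{η*}_{1,ν}D^η_{1,ν}` acting on the component `A_μ` = `(∂*∂ + ∂∂*)A`
read at the bond `⟨x, x + e_μ⟩`, for every `A ∈ ℓ²(bonds of T_η)`: the fourth member of `B8Prop3MultiLevelTorusLap.prop3_multiLevelTorus_V1_pref_lap`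
(stated for `∂*∂ + ∂∂* = dcsE c ∘ dcE c + dE c ∘ dsE c`) IS print's `|Δ^η_{U₀}A|` at `U₀ = 1`.
[cite: Balaban1985RegularSpaces, (1.59) p.86, (1.39) p.83; Balaban1985BackgroundPropagators, (3.23) p.394; Balaban1984PropagatorsI, (1.69) p.29] -/
theorem hodge_apply_eq_sum_covDAdj_covD_one {G : Type*} [GaugeGroup G] (R : G → ℝ →ₗ[ℝ] ℝ) (hR : R 1 = LinearMap.id) (c : ℝ)
    (A : BondSpace P) (b : PBond P 0) :
    (dcsE c (dcE c A) + dE c (dsE c A)) b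
      = ∑ ν : Fin P.d, covDAdj R c (1 : GaugeField P 0 G) ν (covD R c 1 ν (fun z => A ⟨z, b.dir⟩)) b.src := by
  rw [hodge_apply, sum_covDAdj_covD_one R hR]

end

end Literature.MathematicalPhysics.QuantumFieldTheory.Balaban1983to89.B8Eq12HodgeLaplacianV1
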